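import Mathlib.LinearAlgebra.Matrix.PosDef
import Mathlib.LinearAlgebra.Matrix.Trace
import Mathlib.Analysis.Normed.Group.Basic
import HarnessLib

/-!
# Graded compression ("pinching") of a square matrix along a grading of its index set

For a grading `g : ι → G` of the index set (a "charge" / sector label on basis states) the **graded
compression** of `ρ : Matrix ι ι R` keeps the entries inside the sectors of `g` and kills the rest:

  `(gradedCompress g ρ) i j = if g i = g j then ρ i j else 0`,

i.e. `ρ ↦ Σ_q P_q ρ P_q` with `P_q` the coordinate projection onto the sector `{i | g i = q}`
(`gradedCompress_eq_sum_sectorProj`). In quantum information this is the state after a projective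
measurement of the charge whose outcome is not recorded, `ρ' = Σ_i P_i ρ P_i` (Nielsen–Chuang §11.3.3,
eq. (11.65)); in operator-algebra language it is the trace-preserving **conditional expectation** onto the
block-diagonal `*`-subalgebra of the grading (Petz §9.2), a.k.a. the *pinching* of `ρ` by the block decomposition; for the moment /
reduced-density-matrix relaxations of lattice models it is the projection onto the **symmetry sectors** of an
abelian charge (Kull–Schuch–Dive–Navascués §3.3: the variables may be taken block diagonal in the conserved
charge). PROVED here (all elementary, no `sorry`, no named fact): sector zeros and idempotence; invariance under
an injective relabelling of the grading (in particular `g ↦ −g`); additivity / homogeneity / `map` / transpose /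
conjugate transpose / Hermitian; trace preservation; the conditional-expectation (bimodule) identities
`gradedCompress g (X * ρ) = X * gradedCompress g ρ` and `tr (X · gradedCompress g ρ) = tr (X · ρ)` for
`g`-block-diagonal `X`, and self-adjointness for the trace pairing; the entrywise bound
`‖(gradedCompress g ρ) i j‖ ≤ ‖ρ i j‖`; the sum-over-sectors formula and **preservation of positive
semidefiniteness**; and, for a product index `ι × κ` graded by a SUM of gradings `g₁ x.1 + g₂ x.2` in a
cancellative monoid, the intertwining of the compression with the partial trace over either factor
(`sum_gradedCompress_prodSum_apply_right/left`: tracing out a factor of a sector-compressed matrix gives the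
sector compression, for the remaining factor's grading, of the traced-out matrix).

Design: the block-diagonality hypothesis on an observable `X` is kept as the explicit binder
`∀ i j, g i ≠ g j → X i j = 0`; no predicate is introduced. Everything is stated for a general coefficient
type `R` under the minimal algebraic hypotheses; positivity uses Mathlib's `Matrix.PosSemidef` over an ordered
`*`-ring exactly as `Matrix.posSemidef_sum` / `Matrix.PosSemidef.conjTranspose_mul_mul_same` do.

## References
* M. A. Nielsen, I. L. Chuang, *Quantum Computation and Quantum Information* (10th anniversary ed., CUP 2010),
  §11.3.3 "Measurements and entropy", eq. (11.65) `ρ' = Σ_i P_i ρ P_i`, Theorem 11.9 (book p. 515).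
  [cite: NielsenChuang2010, §11.3.3 eq. (11.65)]
* D. Petz, *Quantum Information Theory and Quantum Statistics* (Springer 2008), §9.2 "Conditional expectations":
  definition and module property `E(AB) = A E(B)`, `E(BA) = E(B) A` (eqs. (9.4)–(9.5)), `E` fixes its range and
  commutes with `*`; Example 9.5: the trace-preserving conditional expectation onto a unital `*`-subalgebra is the
  orthogonal projection for `⟨B₁, B₂⟩ = τ(B₁* B₂)` (positivity, self-adjointness) — here the subalgebra is the
  block-diagonal algebra `{X | g i ≠ g j → X i j = 0}` of the grading. [cite: Petz2008, §9.2]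
* I. Kull, N. Schuch, B. Dive, M. Navascués, *Lower bounding ground-state energies of local Hamiltonians through
  the renormalization group*, Phys. Rev. X 14, 021008 (2024) = arXiv:2212.03014, §3.3 (symmetries: the
  relaxation variables restricted to the sectors of a conserved charge). [cite: KullEtAl2024, §3.3]

## Mathlib
Used: `Matrix.PosSemidef.conjTranspose_mul_mul_same`, `Matrix.posSemidef_sum`, `Matrix.trace`,
`Matrix.diagonal`, `Finset.sum_image'`-free bookkeeping via `Finset.sum_ite_eq`. Mathlib (v4.32) has no
pinching / block-compression operator for a general grading (`Matrix.blockDiagonal` is the constructor of a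
block matrix from its blocks, a different object).
-/

namespace Literature.LinearAlgebra.Matrix

open _root_.Matrix Finset
open scoped BigOperators

variable {ι κ G H R S : Type*}

/-! ### Definition and entrywise facts -/

section Defs

variable [DecidableEq G] [Zero R]

/-- **Graded compression (pinching) of `ρ` along the grading `g`**: the matrix that agrees with `ρ` on the
pairs of indices in the same sector of `g` and vanishes across sectors — `Σ_q P_q ρ P_q`, the state after an
unrecorded projective measurement of the charge `g`. [cite: NielsenChuang2010, §11.3.3 eq. (11.65)] -/
def gradedCompress (g : ι → G) (ρ : Matrix ι ι R) : Matrix ι ι R :=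
  Matrix.of fun i j => if g i = g j then ρ i j else 0

/-- Entries of the graded compression (definitional). [cite: NielsenChuang2010, §11.3.3 eq. (11.65)] -/
@[simp] theorem gradedCompress_apply (g : ι → G) (ρ : Matrix ι ι R) (i j : ι) :
    gradedCompress g ρ i j = if g i = g j then ρ i j else 0 := rfl

/-- Inside a sector the compression agrees with `ρ`. [cite: NielsenChuang2010, §11.3.3 eq. (11.65)] -/
theorem gradedCompress_apply_of_eq {g : ι → G} (ρ : Matrix ι ι R) {i j : ι} (h : g i = g j) :
    gradedCompress g ρ i j = ρ i j := by
  simp [h]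

/-- **Sector zeros**: across two different sectors the compression vanishes. [cite: KullEtAl2024, §3.3] -/
theorem gradedCompress_apply_of_ne {g : ι → G} (ρ : Matrix ι ι R) {i j : ι} (h : g i ≠ g j) :
    gradedCompress g ρ i j = 0 := by
  simp [h]

/-- The diagonal is untouched. [cite: NielsenChuang2010, §11.3.3 eq. (11.65)] -/
@[simp] theorem gradedCompress_apply_same (g : ι → G) (ρ : Matrix ι ι R) (i : ι) :
    gradedCompress g ρ i i = ρ i i := by
  simp

/-- A matrix that is already block diagonal in the sectors of `g` is its own compression.
[cite: NielsenChuang2010, §11.3.3 Theorem 11.9 (equality case)] -/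
theorem gradedCompress_of_graded {g : ι → G} {ρ : Matrix ι ι R} (h : ∀ i j, g i ≠ g j → ρ i j = 0) :
    gradedCompress g ρ = ρ := by
  ext i j
  by_cases hij : g i = g j
  · simp [hij]
  · simp [hij, h i j hij]

/-- **Idempotence**: compressing twice is compressing once (`E` acts identically on its range algebra).
[cite: Petz2008, §9.2 (after eq. (9.4))] -/
@[simp] theorem gradedCompress_gradedCompress (g : ι → G) (ρ : Matrix ι ι R) :
    gradedCompress g (gradedCompress g ρ) = gradedCompress g ρ :=
  gradedCompress_of_graded fun _ _ h => gradedCompress_apply_of_ne ρ h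

/-- The compression depends on the grading only through its level sets: an injective relabelling of the
charges does not change it (immediate from the defining formula). [cite: NielsenChuang2010, §11.3.3 eq. (11.65)] -/
theorem gradedCompress_comp_of_injective [DecidableEq H] {f : G → H} (hf : Function.Injective f) (g : ι → G)
    (ρ : Matrix ι ι R) : gradedCompress (f ∘ g) ρ = gradedCompress g ρ := by
  ext i j
  simp only [gradedCompress_apply, Function.comp_apply, hf.eq_iff]

/-- In particular reversing the sign of an additive charge does not change the compression (used for the
staggered charges of a window and of its shifted copy, whose sign patterns are opposite). [cite: NielsenChuang2010, §11.3.3 eq. (11.65)] -/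
theorem gradedCompress_neg {A : Type*} [DecidableEq A] [AddGroup A] (g : ι → A) (ρ : Matrix ι ι R) :
    gradedCompress (-g) ρ = gradedCompress g ρ := by
  ext i j
  simp only [gradedCompress_apply, Pi.neg_apply, neg_inj]

/-- Compression of the zero matrix (the conditional expectation is linear). [cite: Petz2008, §9.2 eqs. (9.4)–(9.5), Example 9.5] -/
@[simp] theorem gradedCompress_zero (g : ι → G) : gradedCompress g (0 : Matrix ι ι R) = 0 := by
  ext i j
  simp

/-- The compression commutes with relabelling the indices (`submatrix` along any map; immediate from the
defining formula). [cite: NielsenChuang2010, §11.3.3 eq. (11.65)] -/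
theorem gradedCompress_submatrix (g : ι → G) (ρ : Matrix ι ι R) (e : κ → ι) :
    (gradedCompress g ρ).submatrix e e = gradedCompress (g ∘ e) (ρ.submatrix e e) := by
  ext i j
  simp

/-- Transpose commutes with the compression (immediate from the defining formula). [cite: NielsenChuang2010, §11.3.3 eq. (11.65)] -/
theorem gradedCompress_transpose (g : ι → G) (ρ : Matrix ι ι R) :
    (gradedCompress g ρ)ᵀ = gradedCompress g ρᵀ := by
  ext i j
  simp only [transpose_apply, gradedCompress_apply, eq_comm]

/-- Entrywise maps fixing `0` commute with the compression (e.g. complex conjugation: a real matrix has a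
real compression; immediate from the defining formula). [cite: NielsenChuang2010, §11.3.3 eq. (11.65)] -/
theorem gradedCompress_map [Zero S] {f : R → S} (hf : f 0 = 0) (g : ι → G) (ρ : Matrix ι ι R) :
    (gradedCompress g ρ).map f = gradedCompress g (ρ.map f) := by
  ext i j
  by_cases h : g i = g j
  · simp [h]
  · simp [h, hf]

end Defs

/-! ### Additivity, `*`, Hermitian -/

section Algebra

variable [DecidableEq G]

/-- Additivity (a conditional expectation is a linear map). [cite: Petz2008, §9.2 eqs. (9.4)–(9.5), Example 9.5] -/
theorem gradedCompress_add [AddZeroClass R] (g : ι → G) (ρ σ : Matrix ι ι R) :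
    gradedCompress g (ρ + σ) = gradedCompress g ρ + gradedCompress g σ := by
  ext i j
  by_cases h : g i = g j
  · simp [h]
  · simp [h]

/-- Compatibility with subtraction (linearity). [cite: Petz2008, §9.2 eqs. (9.4)–(9.5), Example 9.5] -/
theorem gradedCompress_sub [SubNegZeroMonoid R] (g : ι → G) (ρ σ : Matrix ι ι R) :
    gradedCompress g (ρ - σ) = gradedCompress g ρ - gradedCompress g σ := by
  ext i j
  by_cases h : g i = g j
  · simp [h]
  · simp [h]

/-- Homogeneity (linearity). [cite: Petz2008, §9.2 eqs. (9.4)–(9.5), Example 9.5] -/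
theorem gradedCompress_smul {α : Type*} [Zero R] [SMulZeroClass α R] (g : ι → G) (c : α) (ρ : Matrix ι ι R) :
    gradedCompress g (c • ρ) = c • gradedCompress g ρ := by
  ext i j
  by_cases h : g i = g j
  · simp [h]
  · simp [h]

/-- Conjugate transpose commutes with the compression: `E(B*) = E(B)*`. [cite: Petz2008, §9.2 eqs. (9.4)–(9.5), Example 9.5] -/
theorem gradedCompress_conjTranspose [AddMonoid R] [StarAddMonoid R] (g : ι → G) (ρ : Matrix ι ι R) :
    (gradedCompress g ρ)ᴴ = gradedCompress g ρᴴ := by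
  ext i j
  simp only [conjTranspose_apply, gradedCompress_apply]
  by_cases h : g i = g j
  · rw [if_pos h, if_pos h.symm]
  · rw [if_neg h, if_neg (Ne.symm h), star_zero]

/-- The compression of a Hermitian matrix is Hermitian. [cite: NielsenChuang2010, §11.3.3 eq. (11.65)] -/
theorem isHermitian_gradedCompress [AddMonoid R] [StarAddMonoid R] {ρ : Matrix ι ι R} (h : ρ.IsHermitian)
    (g : ι → G) : (gradedCompress g ρ).IsHermitian := by
  unfold Matrix.IsHermitian
  rw [gradedCompress_conjTranspose, h.eq]

/-- Entrywise norm bound: compressing never increases an entry (each entry of the compression is the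
corresponding entry of `ρ` or `0`). [cite: NielsenChuang2010, §11.3.3 eq. (11.65)] -/
theorem norm_gradedCompress_apply_le [SeminormedAddCommGroup R] (g : ι → G) (ρ : Matrix ι ι R) (i j : ι) :
    ‖gradedCompress g ρ i j‖ ≤ ‖ρ i j‖ := by
  by_cases h : g i = g j
  · simp [h]
  · simp [h]

end Algebra

/-! ### Trace, and the conditional-expectation identities -/

section Trace

variable [Fintype ι] [DecidableEq G]

/-- **Trace preservation**: `tr (gradedCompress g ρ) = tr ρ` (the diagonal is untouched). [cite: Petz2008, §9.2 Example 9.5] -/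
@[simp] theorem trace_gradedCompress [AddCommMonoid R] (g : ι → G) (ρ : Matrix ι ι R) :
    (gradedCompress g ρ).trace = ρ.trace := by
  simp [Matrix.trace]

variable [NonUnitalNonAssocSemiring R]

/-- **Bimodule (conditional expectation) property, left**: for a `g`-block-diagonal `X`,
`gradedCompress g (X * ρ) = X * gradedCompress g ρ` — Petz's module property `E(AB) = A E(B)` of the
trace-preserving conditional expectation onto the block-diagonal algebra of `g`. [cite: Petz2008, §9.2 eq. (9.4)] -/
theorem gradedCompress_mul_of_graded_left {g : ι → G} {X : Matrix ι ι R} (hX : ∀ i j, g i ≠ g j → X i j = 0)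
    (ρ : Matrix ι ι R) : gradedCompress g (X * ρ) = X * gradedCompress g ρ := by
  ext i j
  simp only [gradedCompress_apply, Matrix.mul_apply]
  by_cases h : g i = g j
  · rw [if_pos h]
    refine Finset.sum_congr rfl fun k _ => ?_
    by_cases hk : g k = g j
    · rw [if_pos hk]
    · rw [if_neg hk, hX i k (h ▸ fun e => hk e.symm), zero_mul, mul_zero]
  · rw [if_neg h]
    refine (Finset.sum_eq_zero fun k _ => ?_).symm
    by_cases hk : g k = g j
    · rw [hX i k fun e => h (e.trans hk), zero_mul]
    · rw [if_neg hk, mul_zero]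

/-- **Bimodule property, right**: `gradedCompress g (ρ * X) = gradedCompress g ρ * X` for `g`-block-diagonal
`X` (`E(BA) = E(B)A`). [cite: Petz2008, §9.2 eq. (9.5)] -/
theorem gradedCompress_mul_of_graded_right {g : ι → G} {X : Matrix ι ι R} (hX : ∀ i j, g i ≠ g j → X i j = 0)
    (ρ : Matrix ι ι R) : gradedCompress g (ρ * X) = gradedCompress g ρ * X := by
  ext i j
  simp only [gradedCompress_apply, Matrix.mul_apply]
  by_cases h : g i = g j
  · rw [if_pos h]
    refine Finset.sum_congr rfl fun k _ => ?_
    by_cases hk : g i = g k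
    · rw [if_pos hk]
    · rw [if_neg hk, hX k j fun e => hk (h.trans e.symm), mul_zero, zero_mul]
  · rw [if_neg h]
    refine (Finset.sum_eq_zero fun k _ => ?_).symm
    by_cases hk : g i = g k
    · rw [hX k j fun e => h (hk.trans e), mul_zero]
    · rw [if_neg hk, zero_mul]

/-- **Expectations of block-diagonal observables are unchanged**: `tr (X · gradedCompress g ρ) = tr (X · ρ)`
whenever `X i j = 0` across sectors (e.g. a Hamiltonian commuting with the charge).
[cite: KullEtAl2024, §3.3] -/
theorem trace_mul_gradedCompress_of_graded {g : ι → G} {X : Matrix ι ι R}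
    (hX : ∀ i j, g i ≠ g j → X i j = 0) (ρ : Matrix ι ι R) :
    (X * gradedCompress g ρ).trace = (X * ρ).trace := by
  rw [← gradedCompress_mul_of_graded_left hX, trace_gradedCompress]

/-- The same with the observable on the right: `tr (gradedCompress g ρ · X) = tr (ρ · X)`.
[cite: KullEtAl2024, §3.3] -/
theorem trace_gradedCompress_mul_of_graded {g : ι → G} {X : Matrix ι ι R}
    (hX : ∀ i j, g i ≠ g j → X i j = 0) (ρ : Matrix ι ι R) :
    (gradedCompress g ρ * X).trace = (ρ * X).trace := by
  rw [← gradedCompress_mul_of_graded_right hX, trace_gradedCompress]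

/-- **Self-adjointness for the trace pairing**: `tr (X · gradedCompress g ρ) = tr (gradedCompress g X · ρ)` —
the trace-preserving conditional expectation is the orthogonal projection for `⟨B₁, B₂⟩ = tr (B₁* B₂)`.
[cite: Petz2008, §9.2 Example 9.5] -/
theorem trace_mul_gradedCompress_comm (g : ι → G) (X ρ : Matrix ι ι R) :
    (X * gradedCompress g ρ).trace = (gradedCompress g X * ρ).trace := by
  simp only [Matrix.trace, Matrix.diag_apply, Matrix.mul_apply, gradedCompress_apply]
  refine Finset.sum_congr rfl fun i _ => Finset.sum_congr rfl fun k _ => ?_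
  by_cases h : g k = g i
  · rw [if_pos h, if_pos h.symm]
  · rw [if_neg h, if_neg (Ne.symm h), mul_zero, zero_mul]

end Trace

/-! ### Sector projections and positivity -/

section SectorProj

variable [DecidableEq ι] [DecidableEq G]

/-- The coordinate projection onto the sector `{i | g i = q}`: the diagonal 0/1 matrix `P_q`.
[cite: NielsenChuang2010, §11.3.3 eq. (11.65)] -/
def sectorProj [Zero R] [One R] (g : ι → G) (q : G) : Matrix ι ι R :=
  Matrix.diagonal fun i => if g i = q then 1 else 0

/-- Entries of `P_q`. [cite: NielsenChuang2010, §11.3.3 eq. (11.65)] -/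
theorem sectorProj_apply [Zero R] [One R] (g : ι → G) (q : G) (i j : ι) :
    sectorProj (R := R) g q i j = if i = j ∧ g i = q then 1 else 0 := by
  unfold sectorProj
  by_cases h : i = j
  · subst h
    by_cases hq : g i = q <;> simp [hq]
  · simp [h]

/-- `P_q` is self-adjoint. [cite: NielsenChuang2010, §11.3.3 eq. (11.65)] -/
theorem sectorProj_conjTranspose [NonAssocSemiring R] [StarRing R] (g : ι → G) (q : G) :
    (sectorProj (R := R) g q)ᴴ = sectorProj g q := by
  unfold sectorProj
  rw [diagonal_conjTranspose]
  congr 1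
  funext i
  by_cases h : g i = q <;> simp [h]

variable [NonAssocSemiring R]

/-- `(P_q ρ P_q) i j = ρ i j` on the sector `q` and `0` elsewhere. [cite: NielsenChuang2010, §11.3.3 eq. (11.65)] -/
theorem sectorProj_mul_mul_sectorProj_apply [Fintype ι] (g : ι → G) (q : G) (ρ : Matrix ι ι R) (i j : ι) :
    (sectorProj (R := R) g q * ρ * sectorProj (R := R) g q) i j = if g i = q ∧ g j = q then ρ i j else 0 := by
  unfold sectorProj
  rw [Matrix.mul_diagonal, Matrix.diagonal_mul]
  by_cases hi : g i = q <;> by_cases hj : g j = q <;> simp [hi, hj]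

/-- **Sum-over-sectors formula**: `gradedCompress g ρ = Σ_{q ∈ g(ι)} P_q ρ P_q`.
[cite: NielsenChuang2010, §11.3.3 eq. (11.65)] -/
theorem gradedCompress_eq_sum_sectorProj [Fintype ι] (g : ι → G) (ρ : Matrix ι ι R) :
    gradedCompress g ρ = ∑ q ∈ Finset.univ.image g, sectorProj (R := R) g q * ρ * sectorProj (R := R) g q := by
  ext i j
  simp only [Matrix.sum_apply, sectorProj_mul_mul_sectorProj_apply, gradedCompress_apply]
  by_cases h : g i = g j
  · rw [if_pos h]
    rw [Finset.sum_eq_single_of_mem (g i) (Finset.mem_image_of_mem g (Finset.mem_univ i))]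
    · simp [h]
    · intro q _ hq
      rw [if_neg]
      rintro ⟨hiq, -⟩
      exact hq hiq.symm
  · rw [if_neg h]
    refine (Finset.sum_eq_zero fun q _ => ?_).symm
    rw [if_neg]
    rintro ⟨hiq, hjq⟩
    exact h (hiq.trans hjq.symm)

end SectorProj

section PosSemidef

variable [Fintype ι] [DecidableEq ι] [DecidableEq G] [Ring R] [PartialOrder R] [StarRing R] [AddLeftMono R]

/-- **Positivity is preserved**: the graded compression of a positive semidefinite matrix is positive
semidefinite (`Σ_q P_q ρ P_q` is a sum of congruences of `ρ`; a conditional expectation is positive).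
[cite: NielsenChuang2010, §11.3.3 eq. (11.65)] [cite: Petz2008, §9.2 Example 9.5] -/
theorem posSemidef_gradedCompress {ρ : Matrix ι ι R} (hρ : ρ.PosSemidef) (g : ι → G) :
    (gradedCompress g ρ).PosSemidef := by
  rw [gradedCompress_eq_sum_sectorProj]
  refine Matrix.posSemidef_sum _ fun q _ => ?_
  simpa only [sectorProj_conjTranspose] using hρ.conjTranspose_mul_mul_same (sectorProj (R := R) g q)

end PosSemidef

/-! ### Product index graded by a sum of charges: compression intertwines the partial traces -/

section Prod

variable [DecidableEq G] [AddCommMonoid R]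

/-- **Tracing out the right factor intertwines the compressions** when the grading of `ι × κ` is the sum
`g₁ x.1 + g₂ x.2` of gradings of the factors (right-cancellative charges): for all `a a' : ι`,
`Σ_b (gradedCompress (g₁ ⊕ g₂) ρ) (a,b) (a',b) = (gradedCompress g₁ (tr_κ ρ)) a a'` with
`(tr_κ ρ) a a' = Σ_b ρ (a,b) (a',b)`. This is the sector bookkeeping behind "the marginal of a
charge-block-diagonal state is charge-block-diagonal". [cite: KullEtAl2024, §3.3] -/
theorem sum_gradedCompress_prodSum_apply_right [Fintype κ] [Add G] [IsRightCancelAdd G]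
    (g₁ : ι → G) (g₂ : κ → G) (ρ : Matrix (ι × κ) (ι × κ) R) (a a' : ι) :
    ∑ b, gradedCompress (fun x : ι × κ => g₁ x.1 + g₂ x.2) ρ (a, b) (a', b)
      = gradedCompress g₁ (Matrix.of fun c c' : ι => ∑ b, ρ (c, b) (c', b)) a a' := by
  simp only [gradedCompress_apply, Matrix.of_apply, add_left_inj]
  by_cases h : g₁ a = g₁ a'
  · simp [h]
  · simp [h]

/-- **Tracing out the left factor**, symmetrically (left-cancellative charges):
`Σ_a (gradedCompress (g₁ ⊕ g₂) ρ) (a,b) (a,b') = (gradedCompress g₂ (tr_ι ρ)) b b'`. [cite: KullEtAl2024, §3.3] -/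
theorem sum_gradedCompress_prodSum_apply_left [Fintype ι] [Add G] [IsLeftCancelAdd G]
    (g₁ : ι → G) (g₂ : κ → G) (ρ : Matrix (ι × κ) (ι × κ) R) (b b' : κ) :
    ∑ a, gradedCompress (fun x : ι × κ => g₁ x.1 + g₂ x.2) ρ (a, b) (a, b')
      = gradedCompress g₂ (Matrix.of fun c c' : κ => ∑ a, ρ (a, c) (a, c')) b b' := by
  simp only [gradedCompress_apply, Matrix.of_apply, add_right_inj]
  by_cases h : g₂ b = g₂ b'
  · simp [h]
  · simp [h]

end Prod

end Literature.LinearAlgebra.Matrix
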